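import Literature.NumberTheory.Automorphic.LocalLanglandsGLProofs
import Literature.NumberTheory.Automorphic.RankinSelbergLocalGLOne
import Literature.NumberTheory.Automorphic.WhittakerTwistedJacquet
import Literature.NumberTheory.Automorphic.LocalConstantsUniqueness
import Literature.NumberTheory.Automorphic.GKModulesAdmissible
import Literature.NumberTheory.GaloisRepresentations.LocalClassFieldTheoryGL1Proofs
import Literature.NumberTheory.GaloisRepresentations.WeilGroupProofs
import HarnessLib

/-!
# The local Langlands correspondence for `GL₁` (and `GL₀`) on isomorphism classes

Topic `Literature/NumberTheory/Automorphic`, companion of `LocalLanglandsGL` (statement **lang.S09**: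
the property `IsLocalLanglandsGL F … d 𝓔 rec` of a family
`rec_n : Irr(GL_n(F)) → {Frobenius-semisimple n-dimensional Weil–Deligne representations}/≅`,
Harris–Taylor 2001, Thm. A; Henniart 2000, Thm. 1.2) and of `LocalLanglandsDatum`.

Let `F` be a non-archimedean local field and `d` a local Artin datum (`LocalArtinData F`,
`artin : W_F →* Fˣ`).  This file settles the part of lang.S09 that does not involve `GL_n` for
`n ≥ 2`, unconditionally, in the exact vocabulary of `IsLocalLanglandsGL`:

* **Automorphic side.** An irreducible smooth representation `π` of `GL₁(F)` (a `SmoothIrrep`, on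
  a space `V : Type`) is a line (`finrank_eq_one_of_isIrreducible_of_le_one`, proved in
  `WhittakerTwistedJacquet` by Schur's lemma in countable dimension), on which `GL₁(F)` acts through
  a unique continuous quasi-character: `π(g) = χ_π(det g)` (`SmoothIrrep.existsUnique_quasiChar`;
  continuity because `χ_π ∘ det` is trivial on the open stabiliser of a non-zero vector).  Hence
  `[π] ↦ χ_π` is a bijection `Irr(GL₁(F)) ≃ (Fˣ →ₜ* ℂˣ)` (`IrrClass.quasiChar`,
  `IrrClass.quasiChar_bijective`), with inverse `χ ↦ [χ ∘ det]` (`SmoothIrrep.ofQuasiChar`, smooth by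
  `isOpen_ker_quasiChar_holds`).  (Bushnell–Henniart 2006, §1.5.)
* **Galois side.** A Weil–Deligne representation on a complex line is `(χ ∘ artin, N = 0)` for a
  unique quasi-character `χ` (`WeilDeligneRep.existsUnique_isEquivalent_ofQuasiChar`): a nilpotent
  scalar vanishes, `W_F` acts through a character which is continuous since it is trivial on an open
  subgroup of inertia (`WeilGroup.isTopologicalGroup_holds`), and continuous characters of `W_F` are
  `χ ∘ artin` by local class field theory for `GL₁` (`LocalArtinData.recGL1_bijective_holds`).
  (Tate, Corvallis 1979, (1.4.5), (2.1), (4.1.3).)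
* **The reciprocity map** `recGLOne hns d : Irr(GL₁(F)) → {1-dim Frobenius-semisimple WD reps}/≅`,
  `[π] ↦ [(χ_π ∘ artin, 0)]` realised on the fixed line `Fin 1 → ℂ` (`WeilDeligneRep.ofQuasiCharOn`),
  satisfies every degree-`1` clause of `IsLocalLanglandsGL`: it is a bijection (`recGLOne_bijective`,
  clause `bijective 1`), it is local class field theory (`recGLOne_gl_one`, clause `gl_one`), it is
  compatible with central characters (`recGLOne_centralChar`, clause `centralChar 1`) and with twists
  (`recGLOne_twist`, clause `twist 1`).  In degree `0` both sides are singletons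
  (`IrrClass.subsingleton_glZero`, `subsingleton_frobSemisimpleWDSetoid_zero`); the unique map
  `recGLZero` is a bijection and the clauses `centralChar 0`, `twist 0` hold for any `rec₀`
  (`centralChar_glZero`, `twist_glZero`).  (The `L`/`ε` clauses of pairs require `0 < m < n`, so
  they first appear for `GL₂ × GL₁`.)
* **Uniqueness.** Every local Langlands correspondence restricts to these maps:
  `IsLocalLanglandsGL F … d 𝓔 rec → rec 1 = recGLOne hns d ∧ rec 0 = recGLZero`
  (`IsLocalLanglandsGL.rec_one_eq_recGLOne`, `IsLocalLanglandsGL.rec_zero_eq_recGLZero`): clause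
  `gl_one` pins `rec₁` on every class.  (Harris–Taylor 2001, Thm. A (i): "`rec_K` restricted to
  `GL₁` is local class field theory".)

Supporting generalities (proved here, no named facts): an endomorphism of a line is a scalar
(`Module.End.exists_eq_smul_id_of_finrank_eq_one`), a representation on a line is a character
(`Representation.existsUnique_character_of_finrank_eq_one`), a homomorphism of topological groups
with open kernel is continuous (`continuous_monoidHom_of_isOpen_ker`), `GL₁(R) = Rˣ` via
`det`/`scalar` (`scalar_det_fin_one`), conjugation invariance of `det ρ(w)` under isomorphism of
Weil–Deligne representations (`WeilDeligneRep.IsEquivalent.det_ρ_eq`), and `⊗` of Weil–Deligne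
representations is compatible with isomorphisms on the left (`WeilDeligneRep.Equiv.tprodLeft`) and
multiplies quasi-characters (`WeilDeligneRep.ofQuasiCharOnTprodEquiv`).

## Mathlib / tree declarations used rather than redefined

Mathlib: `Representation.Equiv` (`Equiv.mk`), `Representation.IsIrreducible`, `finrank_eq_one_iff'`,
`LinearEquiv.ofFinrankEq`, `LinearMap.det_conj`, `LinearMap.det_smul`,
`LinearMap.det_eq_one_of_finrank_eq_zero`, `Module.End.IsSemisimple_smul`, `continuous_of_continuousAt_one`,
`Continuous.units_map`, `Matrix.GeneralLinearGroup.scalar`/`det`, `TensorProduct.congr`/`rid`,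
`Quotient.out` API.  Tree: `SmoothIrrep`, `IrrClass` (`IrreducibleClasses`), `glOneRep`,
`isSmooth_glOneRep` (`RankinSelbergLocal(GLOne)`), `finrank_eq_one_of_isIrreducible_of_le_one`
(`WhittakerTwistedJacquet`), `WeilDeligneRep.ofQuasiChar`, `tprod`, `charDet` (`LocalConstants`,
`LocalLanglandsGL`), `WeilDeligneRep.isEquivalent_of_subsingleton` (`LocalConstantsUniqueness`),
`isIrreducible_trivial_self` (`GKModulesAdmissible`), and the discharged named facts
`isOpen_ker_quasiChar_holds`, `LocalArtinData.recGL1_bijective_holds`,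
`WeilGroup.isTopologicalGroup_holds`.  Nothing here is a named fact; every declaration is proved.
The no-small-subgroups fact enters only as the explicit hypothesis `hns` carried by
`WeilDeligneRep.ofQuasiChar` (as in `IsLocalLanglandsGL`), never as an assumption of a theorem's truth.

## Design notes

* `recGLOne` needs Weil–Deligne representations on the FIXED space `Fin 1 → ℂ` (the setoid
  `frobSemisimpleWDSetoid F 1`), while `WeilDeligneRep.ofQuasiChar` lives on `ℂ`; the general
  `WeilDeligneRep.ofQuasiCharOn V` (scalar action of `χ ∘ artin` on any `V`) bridges the two
  (`ofQuasiCharOn_complex : ofQuasiCharOn ℂ hns d χ = ofQuasiChar hns d χ` by `rfl`,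
  `ofQuasiCharOnEquiv` along any linear isomorphism).
* `IrrClass.quasiChar` is `Quotient.lift` of the chosen character of a representative, well defined
  by transport of the defining identity along an isomorphism (`SmoothIrrep.quasiChar_transport`).
* `F : Type*` throughout, except in the uniqueness section where `IsLocalLanglandsGL` forces
  `F : Type`.

## References

* M. Harris, R. Taylor, *The geometry and cohomology of some simple Shimura varieties*, Ann. of
  Math. Stud. 151 (2001), Thm. A (i), (ii), (iv). [HarrisTaylorAMS2001]
* G. Henniart, *Une preuve simple des conjectures de Langlands pour GL(n) sur un corps p-adique*,
  Invent. Math. 139 (2000), Thm. 1.2. [HenniartInventiones2000]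
* J. Tate, *Number theoretic background*, Proc. Sympos. Pure Math. XXXIII (Corvallis 1977), Part 2,
  AMS 1979, (1.4.5), (2.1), (4.1.3), (4.1.5). [Corvallis1979]
* C. J. Bushnell, G. Henniart, *The local Langlands conjecture for `GL(2)`*, Grundlehren 335 (2006),
  §1.5 (characters of `F^×`), §9.1 (twisting), §33 (the correspondence in dimension one).
  [BushnellHenniart2006]
-/

noncomputable section

open scoped MatrixGroups
open Module

/-! ### Representations on a line act through a character -/

namespace Representation

variable {k G V : Type*} [Field k] [Group G] [AddCommGroup V] [Module k V]

/-- On a one-dimensional vector space every endomorphism is a scalar multiple of the identity.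
[folklore] -/
theorem _root_.Module.End.exists_eq_smul_id_of_finrank_eq_one (h : finrank k V = 1)
    (f : Module.End k V) : ∃ c : k, f = c • LinearMap.id := by
  obtain ⟨v, -, hspan⟩ := finrank_eq_one_iff'.1 h
  obtain ⟨c, hc⟩ := hspan (f v)
  refine ⟨c, LinearMap.ext fun w => ?_⟩
  obtain ⟨a, rfl⟩ := hspan w
  rw [LinearMap.smul_apply, LinearMap.id_apply, map_smul, ← hc, smul_comm]

/-- On a non-zero vector space the scalar `c` of `c • id` is determined. [folklore] -/
theorem _root_.Module.End.smul_id_injective (k V : Type*) [Field k] [AddCommGroup V] [Module k V]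
    [Nontrivial V] : Function.Injective fun c : k => (c • LinearMap.id : Module.End k V) := by
  intro c c' h
  obtain ⟨v, hv⟩ := exists_ne (0 : V)
  have h' := congr($h v)
  simp only [LinearMap.smul_apply, LinearMap.id_apply] at h'
  exact smul_left_injective k hv h'

/-- **A representation on a line is a character**: if `finrank k V = 1`, there is a unique
homomorphism `θ : G →* kˣ` with `ρ(g) v = θ(g) • v` for all `g`, `v`.
(Bushnell–Henniart, *The local Langlands conjecture for `GL(2)`* (2006), §1.5; folklore.)
[folklore] -/
theorem existsUnique_character_of_finrank_eq_one (ρ : Representation k G V)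
    (h : finrank k V = 1) :
    ∃! θ : G →* kˣ, ∀ (g : G) (v : V), ρ g v = ((θ g : kˣ) : k) • v := by
  haveI : Nontrivial V := Module.nontrivial_of_finrank_eq_succ h
  have hinj := Module.End.smul_id_injective k V
  choose c hc using fun g => Module.End.exists_eq_smul_id_of_finrank_eq_one h (ρ g)
  have hc1 : c 1 = 1 := hinj (by simp only; rw [← hc 1, map_one, one_smul]; rfl)
  have hcmul : ∀ g g' : G, c (g * g') = c g * c g' := fun g g' =>
    hinj (by simp only; rw [← hc (g * g'), map_mul, hc g, hc g', mul_smul]; rfl)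
  let θ₀ : G →* k := { toFun := c, map_one' := hc1, map_mul' := hcmul }
  refine ⟨θ₀.toHomUnits, fun g v => ?_, fun θ' hθ' => ?_⟩
  · rw [MonoidHom.coe_toHomUnits]
    exact congr($(hc g) v)
  · ext g
    obtain ⟨v, hv⟩ := exists_ne (0 : V)
    rw [MonoidHom.coe_toHomUnits]
    refine smul_left_injective k hv ?_
    simp only
    rw [← hθ' g v]
    exact congr($(hc g) v)

end Representation

namespace Literature.NumberTheory.Automorphic

open Literature.NumberTheory.GaloisRepresentations
open Literature.NumberTheory.GaloisRepresentations.WeilDeligneRep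

/-! ### `GL₁ = Fˣ`: scalar matrices and the determinant -/

section GLOneGroup

variable {R : Type*} [CommRing R]

/-- In `GL₁` every element is the scalar matrix of its determinant. [folklore] -/
theorem scalar_det_fin_one (g : GL (Fin 1) R) :
    Matrix.GeneralLinearGroup.scalar (Fin 1) (Matrix.GeneralLinearGroup.det g) = g := by
  ext i j
  obtain rfl : i = 0 := Subsingleton.elim _ _
  obtain rfl : j = 0 := Subsingleton.elim _ _
  rw [Matrix.GeneralLinearGroup.coe_scalar, Matrix.scalar_apply, Matrix.diagonal_apply_eq,
    Matrix.GeneralLinearGroup.val_det_apply, Matrix.det_fin_one]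

/-- `det (scalar a) = a` in `GL₁`. [folklore] -/
theorem det_scalar_fin_one (a : Rˣ) :
    Matrix.GeneralLinearGroup.det (Matrix.GeneralLinearGroup.scalar (Fin 1) a) = a := by
  rw [Matrix.GeneralLinearGroup.det_scalar, Fintype.card_fin, pow_one]

/-- `det : GL₁(R) → Rˣ` is surjective. [folklore] -/
theorem det_fin_one_surjective :
    Function.Surjective (Matrix.GeneralLinearGroup.det : GL (Fin 1) R →* Rˣ) := fun a =>
  ⟨_, det_scalar_fin_one a⟩

/-- The scalar embedding `Rˣ → GL₁(R)` is continuous. [folklore] -/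
theorem continuous_scalar_fin_one [TopologicalSpace R] [IsTopologicalRing R] :
    Continuous (Matrix.GeneralLinearGroup.scalar (Fin 1) : Rˣ → GL (Fin 1) R) := by
  refine Continuous.units_map _ ?_
  change Continuous fun a : R => Matrix.scalar (Fin 1) a
  simp_rw [Matrix.scalar_apply]
  exact (continuous_pi fun _ => continuous_id).matrix_diagonal

end GLOneGroup

/-! ### Automorphic side: irreducible smooth representations of `GL₁(F)` are quasi-characters -/

section Automorphic

variable {F : Type*} [Field F] [ValuativeRel F] [TopologicalSpace F] [IsNonarchimedeanLocalField F]

/-- An irreducible smooth representation of `GL₁(F)` is one-dimensional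
(`finrank_eq_one_of_isIrreducible_of_le_one`). (Bushnell–Henniart 2006, §1.5.) [folklore] -/
theorem SmoothIrrep.finrank_eq_one_glOne (π : SmoothIrrep (GL (Fin 1) F)) : finrank ℂ π.V = 1 :=
  finrank_eq_one_of_isIrreducible_of_le_one π.ρ le_rfl π.isSmooth

/-- A homomorphism from a topological group to a topological group whose kernel is open is
continuous. [folklore] -/
theorem continuous_monoidHom_of_isOpen_ker {G H : Type*} [Group G] [TopologicalSpace G]
    [IsTopologicalGroup G] [Group H] [TopologicalSpace H] [IsTopologicalGroup H] (θ : G →* H)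
    (hθ : IsOpen (θ.ker : Set G)) : Continuous θ := by
  refine continuous_of_continuousAt_one θ ?_
  rw [ContinuousAt, map_one]
  refine Filter.tendsto_def.2 fun U hU => Filter.mem_of_superset (hθ.mem_nhds θ.ker.one_mem) ?_
  intro g hg
  simp only [SetLike.mem_coe, MonoidHom.mem_ker] at hg
  simp only [Set.mem_preimage, hg]
  exact mem_of_mem_nhds hU

/-- **Irreducible smooth representations of `GL₁(F)` are quasi-characters.** For an irreducible
smooth `π` of `GL₁(F)` there is a unique continuous quasi-character `χ : Fˣ →ₜ* ℂˣ` such that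
`π(g) = χ(det g)` for all `g`: `π` is a line (`finrank_eq_one_of_isIrreducible_of_le_one`), on
which `GL₁(F)` acts through a character `θ`; `θ` is trivial on the open stabiliser of a non-zero
vector, hence continuous, and `χ = θ ∘ scalar`. (Bushnell–Henniart 2006, §1.5: the irreducible
smooth representations of `F^×` are its characters.) [folklore] -/
theorem SmoothIrrep.existsUnique_quasiChar (π : SmoothIrrep (GL (Fin 1) F)) :
    ∃! χ : QuasiChar F, ∀ (g : GL (Fin 1) F) (v : π.V),
      π.ρ g v = ((χ (Matrix.GeneralLinearGroup.det g) : ℂˣ) : ℂ) • v := by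
  have h1 := π.finrank_eq_one_glOne
  haveI : Nontrivial π.V := Module.nontrivial_of_finrank_eq_succ h1
  obtain ⟨θ, hθ, -⟩ := π.ρ.existsUnique_character_of_finrank_eq_one h1
  obtain ⟨e, he⟩ := exists_ne (0 : π.V)
  -- `ker θ` contains the open stabiliser of `e`
  have hker : IsOpen (θ.ker : Set (GL (Fin 1) F)) := by
    refine Subgroup.isOpen_mono ?_ (π.isSmooth e)
    intro g hg
    rw [Representation.mem_stabilizerSubgroup] at hg
    rw [MonoidHom.mem_ker]
    ext
    refine smul_left_injective ℂ he ?_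
    simp only [Units.val_one, one_smul]
    rw [← hθ g e, hg]
  have hcont : Continuous θ := continuous_monoidHom_of_isOpen_ker θ hker
  let χ : QuasiChar F :=
    { toMonoidHom := θ.comp (Matrix.GeneralLinearGroup.scalar (Fin 1))
      continuous_toFun := hcont.comp continuous_scalar_fin_one }
  have hχ : ∀ g : GL (Fin 1) F, χ (Matrix.GeneralLinearGroup.det g) = θ g := fun g => by
    change θ (Matrix.GeneralLinearGroup.scalar (Fin 1) (Matrix.GeneralLinearGroup.det g)) = θ g
    rw [scalar_det_fin_one]
  refine ⟨χ, fun g v => by rw [hχ g, hθ g v], fun χ' hχ' => ?_⟩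
  refine ContinuousMonoidHom.ext fun a => ?_
  obtain ⟨g, rfl⟩ := det_fin_one_surjective a
  ext
  refine smul_left_injective ℂ he ?_
  simp only
  rw [← hχ' g e, hχ g, hθ g e]

omit [ValuativeRel F] [IsNonarchimedeanLocalField F] in
/-- Isomorphic irreducible smooth representations of `GL₁(F)` act through the same
quasi-character. [folklore] -/
theorem SmoothIrrep.quasiChar_transport {π π' : SmoothIrrep (GL (Fin 1) F)} (e : π.ρ.Equiv π'.ρ)
    {χ : QuasiChar F}
    (h : ∀ (g : GL (Fin 1) F) (v : π.V),
      π.ρ g v = ((χ (Matrix.GeneralLinearGroup.det g) : ℂˣ) : ℂ) • v)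
    (g : GL (Fin 1) F) (v' : π'.V) :
    π'.ρ g v' = ((χ (Matrix.GeneralLinearGroup.det g) : ℂˣ) : ℂ) • v' := by
  obtain ⟨v, rfl⟩ := e.toLinearEquiv.surjective v'
  have h1 := e.toIntertwiningMap.isIntertwining π.ρ π'.ρ g v
  rw [Representation.Equiv.coe_toIntertwiningMap] at h1
  rw [Representation.Equiv.toLinearEquiv_apply, Representation.Equiv.coe_toIntertwiningMap, ← h1,
    h g v, map_smul]

/-- Two irreducible smooth representations of `GL₁(F)` acting through the same quasi-character
are isomorphic (both are lines). [folklore] -/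
theorem SmoothIrrep.nonempty_equiv_of_quasiChar {π π' : SmoothIrrep (GL (Fin 1) F)} {χ : QuasiChar F}
    (h : ∀ (g : GL (Fin 1) F) (v : π.V),
      π.ρ g v = ((χ (Matrix.GeneralLinearGroup.det g) : ℂˣ) : ℂ) • v)
    (h' : ∀ (g : GL (Fin 1) F) (v : π'.V),
      π'.ρ g v = ((χ (Matrix.GeneralLinearGroup.det g) : ℂˣ) : ℂ) • v) :
    Nonempty (π.ρ.Equiv π'.ρ) := by
  have h1 := π.finrank_eq_one_glOne
  have h1' := π'.finrank_eq_one_glOne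
  haveI : Module.Finite ℂ π.V := Module.finite_of_finrank_eq_succ h1
  haveI : Module.Finite ℂ π'.V := Module.finite_of_finrank_eq_succ h1'
  let f : π.V ≃ₗ[ℂ] π'.V := LinearEquiv.ofFinrankEq π.V π'.V (h1.trans h1'.symm)
  refine ⟨Representation.Equiv.mk f fun g => LinearMap.ext fun v => ?_⟩
  simp only [LinearMap.coe_comp, Function.comp_apply, LinearEquiv.coe_coe]
  rw [h g v, h' g (f v), map_smul]

/-- The irreducible smooth representation `χ ∘ det` of `GL₁(F)` on `ℂ` attached to a
quasi-character `χ` (`glOneRep`; smooth because `ker χ` is open, `isOpen_ker_quasiChar_holds`).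
(Bushnell–Henniart 2006, §1.5.) [folklore] -/
def SmoothIrrep.ofQuasiChar (χ : QuasiChar F) : SmoothIrrep (GL (Fin 1) F) where
  V := ℂ
  ρ := glOneRep (χ : Fˣ →* ℂˣ)
  isIrreducible := isIrreducible_glOneRep _
  isSmooth := isSmooth_glOneRep (isOpen_ker_quasiChar_holds χ)

/-- `SmoothIrrep.ofQuasiChar χ` acts through `χ ∘ det`. [folklore] -/
theorem SmoothIrrep.ofQuasiChar_ρ_apply (χ : QuasiChar F) (g : GL (Fin 1) F)
    (v : (SmoothIrrep.ofQuasiChar χ).V) :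
    (SmoothIrrep.ofQuasiChar χ).ρ g v = ((χ (Matrix.GeneralLinearGroup.det g) : ℂˣ) : ℂ) • v :=
  rfl

end Automorphic

/-! ### Galois side: one-dimensional Weil–Deligne representations are quasi-characters -/

section Galois

variable {F : Type*} [Field F] [ValuativeRel F] [TopologicalSpace F] [IsNonarchimedeanLocalField F]
  {V : Type*} [AddCommGroup V] [Module ℂ V] {V' : Type*} [AddCommGroup V'] [Module ℂ V']

variable (V) in
/-- The scalar representation `w ↦ t(w) • id_V` of `W_F` on a complex vector space `V` attached
to a character `t : W_F →ₜ* ℂˣ`; for `V = ℂ` this is `WeilGroup.charRep t`.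
(Tate, *Number theoretic background* (Corvallis 1979), (2.2).) [cite: Corvallis1979, (2.2)] -/
def _root_.Literature.NumberTheory.GaloisRepresentations.WeilGroup.charRepOn
    (t : WeilGroup F →ₜ* ℂˣ) : Representation ℂ (WeilGroup F) V :=
  (DistribMulAction.toModuleEnd ℂ V).comp ((Units.coeHom ℂ).comp t.toMonoidHom)

/-- `charRepOn V t w v = t(w) • v`. [folklore] -/
@[simp] theorem _root_.Literature.NumberTheory.GaloisRepresentations.WeilGroup.charRepOn_apply
    (t : WeilGroup F →ₜ* ℂˣ) (w : WeilGroup F) (v : V) :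
    WeilGroup.charRepOn V t w v = ((t w : ℂˣ) : ℂ) • v :=
  rfl

/-- `charRepOn V t` is continuous for the discrete topology on `V`
(`WeilGroup.IsContinuousRep`), given the no-small-subgroups fact `hns`. [folklore] -/
theorem _root_.Literature.NumberTheory.GaloisRepresentations.WeilGroup.isContinuousRep_charRepOn
    (hns : WeilGroup.exists_subgroup_le_inertia_isOpen_of_continuous (F := F))
    (t : WeilGroup F →ₜ* ℂˣ) : WeilGroup.IsContinuousRep (WeilGroup.charRepOn V t) := by
  obtain ⟨U, hU, hUo, ht⟩ := hns t
  refine ⟨U, hU, hUo, fun u hu => ?_⟩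
  ext v
  simp [ht u hu]

variable (V) in
/-- **The Weil–Deligne representation of a quasi-character on a given line** (or any space):
`(χ ∘ artin acting by scalars on V, N = 0)`, for a local Artin datum `d`; on `V = ℂ` this is
`WeilDeligneRep.ofQuasiChar hns d χ` (`ofQuasiCharOn_complex`), and on `V = Fin 1 → ℂ` it is the
representative used for classes of `1`-dimensional Weil–Deligne representations
(`frobSemisimpleWDSetoid F 1`).
(Tate, *Number theoretic background* (Corvallis 1979), (1.4.5), (4.1.3).)
[cite: Corvallis1979, (1.4.5)] -/
def _root_.Literature.NumberTheory.GaloisRepresentations.WeilDeligneRep.ofQuasiCharOn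
    (hns : WeilGroup.exists_subgroup_le_inertia_isOpen_of_continuous (F := F))
    (d : LocalArtinData F) (χ : QuasiChar F) : WeilDeligneRep F ℂ V :=
  ofRep (WeilGroup.charRepOn V (d.recGL1 χ)) (WeilGroup.isContinuousRep_charRepOn hns _)

/-- `(ofQuasiCharOn V hns d χ).ρ w v = χ(artin w) • v`. [folklore] -/
@[simp] theorem _root_.Literature.NumberTheory.GaloisRepresentations.WeilDeligneRep.ofQuasiCharOn_ρ_apply
    (hns : WeilGroup.exists_subgroup_le_inertia_isOpen_of_continuous (F := F))
    (d : LocalArtinData F) (χ : QuasiChar F) (w : WeilGroup F) (v : V) :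
    (ofQuasiCharOn V hns d χ).ρ w v = ((χ (d.artin w) : ℂˣ) : ℂ) • v :=
  rfl

/-- `(ofQuasiCharOn V hns d χ).N = 0`. [folklore] -/
@[simp] theorem _root_.Literature.NumberTheory.GaloisRepresentations.WeilDeligneRep.ofQuasiCharOn_N
    (hns : WeilGroup.exists_subgroup_le_inertia_isOpen_of_continuous (F := F))
    (d : LocalArtinData F) (χ : QuasiChar F) : (ofQuasiCharOn V hns d χ).N = 0 :=
  rfl

/-- On `ℂ` the two constructions agree: `ofQuasiCharOn ℂ hns d χ = ofQuasiChar hns d χ`.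
[folklore] -/
theorem _root_.Literature.NumberTheory.GaloisRepresentations.WeilDeligneRep.ofQuasiCharOn_complex
    (hns : WeilGroup.exists_subgroup_le_inertia_isOpen_of_continuous (F := F))
    (d : LocalArtinData F) (χ : QuasiChar F) : ofQuasiCharOn ℂ hns d χ = ofQuasiChar hns d χ :=
  rfl

/-- `ofQuasiCharOn V hns d χ` is Frobenius-semisimple (every `ρ(w)` is a scalar). [folklore] -/
theorem _root_.Literature.NumberTheory.GaloisRepresentations.WeilDeligneRep.isFrobSemisimple_ofQuasiCharOn
    (hns : WeilGroup.exists_subgroup_le_inertia_isOpen_of_continuous (F := F))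
    (d : LocalArtinData F) (χ : QuasiChar F) : (ofQuasiCharOn V hns d χ).IsFrobSemisimple := by
  intro w
  have h : (ofQuasiCharOn V hns d χ).ρ w = ((χ (d.artin w) : ℂˣ) : ℂ) • LinearMap.id :=
    LinearMap.ext fun v => rfl
  rw [h]
  exact Module.End.IsSemisimple_smul _ Module.End.isSemisimple_id

/-- `ofQuasiCharOn` on two spaces related by a linear isomorphism gives isomorphic Weil–Deligne
representations. [folklore] -/
def _root_.Literature.NumberTheory.GaloisRepresentations.WeilDeligneRep.ofQuasiCharOnEquiv
    (hns : WeilGroup.exists_subgroup_le_inertia_isOpen_of_continuous (F := F))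
    (d : LocalArtinData F) (χ : QuasiChar F) (e : V ≃ₗ[ℂ] V') :
    Equiv (ofQuasiCharOn V hns d χ) (ofQuasiCharOn V' hns d χ) where
  toRepEquiv := Representation.Equiv.mk e fun w => LinearMap.ext fun v => by
    simp only [LinearMap.coe_comp, Function.comp_apply, LinearEquiv.coe_coe, ofQuasiCharOn_ρ_apply,
      map_smul]
  comm_N := by
    rw [ofQuasiCharOn_N, ofQuasiCharOn_N, LinearMap.comp_zero, LinearMap.zero_comp]

/-- The quasi-character is determined by the isomorphism class of `ofQuasiCharOn V hns d χ`
(for `V ≠ 0`): an isomorphism intertwines the scalars `χ(artin w)` and `χ'(artin w)`, and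
`artin` is surjective. [folklore] -/
theorem _root_.Literature.NumberTheory.GaloisRepresentations.WeilDeligneRep.quasiChar_eq_of_isEquivalent_ofQuasiCharOn
    [Nontrivial V] (hns : WeilGroup.exists_subgroup_le_inertia_isOpen_of_continuous (F := F))
    (d : LocalArtinData F) {χ χ' : QuasiChar F}
    (h : (ofQuasiCharOn V hns d χ).IsEquivalent (ofQuasiCharOn V' hns d χ')) : χ = χ' := by
  obtain ⟨e⟩ := h
  refine d.recGL1_injective (ContinuousMonoidHom.ext fun w => Units.ext ?_)
  rw [LocalArtinData.recGL1_apply, LocalArtinData.recGL1_apply]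
  obtain ⟨v, hv⟩ := exists_ne (0 : V)
  have hev : e.toLinearEquiv v ≠ 0 := e.toLinearEquiv.map_ne_zero_iff.2 hv
  refine smul_left_injective ℂ hev ?_
  have h1 := e.toIntertwiningMap.isIntertwining _ _ w v
  rw [Representation.Equiv.coe_toIntertwiningMap] at h1
  simp only
  rw [Representation.Equiv.toLinearEquiv_apply, Representation.Equiv.coe_toIntertwiningMap,
    ← ofQuasiCharOn_ρ_apply hns d χ' w, ← h1, ofQuasiCharOn_ρ_apply, map_smul]

/-- **One-dimensional Weil–Deligne representations are quasi-characters.** A Weil–Deligne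
representation `r` on a complex line `V` is isomorphic to `(χ ∘ artin, 0)` for a unique
quasi-character `χ` of `Fˣ`: its monodromy is a nilpotent scalar, hence `0`; `W_F` acts through a
character `t`, continuous because it is trivial on an open subgroup of inertia (`W_F` is a
topological group, `WeilGroup.isTopologicalGroup_holds`); and `t = χ ∘ artin` for a unique `χ`
by local class field theory for `GL₁` (`LocalArtinData.recGL1_bijective_holds`).
(Tate, *Number theoretic background* (Corvallis 1979), (1.4.5), (2.1), (4.1.3).)
[cite: Corvallis1979, (1.4.5)] -/
theorem _root_.Literature.NumberTheory.GaloisRepresentations.WeilDeligneRep.existsUnique_isEquivalent_ofQuasiChar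
    (hns : WeilGroup.exists_subgroup_le_inertia_isOpen_of_continuous (F := F))
    (d : LocalArtinData F) (r : WeilDeligneRep F ℂ V) (h1 : finrank ℂ V = 1) :
    ∃! χ : QuasiChar F, r.IsEquivalent (ofQuasiChar hns d χ) := by
  haveI : Nontrivial V := Module.nontrivial_of_finrank_eq_succ h1
  haveI : Module.Finite ℂ V := Module.finite_of_finrank_eq_succ h1
  haveI : IsTopologicalGroup (WeilGroup F) := WeilGroup.isTopologicalGroup_holds F
  -- the monodromy vanishes
  have hN : r.N = 0 := by
    obtain ⟨c, hc⟩ := Module.End.exists_eq_smul_id_of_finrank_eq_one h1 r.N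
    obtain ⟨k, hk⟩ := r.isNilpotent_N
    rw [hc, smul_pow, ← Module.End.one_eq_id, one_pow] at hk
    have hck : c ^ k = 0 := Module.End.smul_id_injective ℂ V (by
      simp only
      rw [← Module.End.one_eq_id, hk, zero_smul])
    rw [hc, pow_eq_zero_iff'.1 hck |>.1, zero_smul]
  -- `W_F` acts through a continuous character
  obtain ⟨t₀, ht₀, -⟩ := r.ρ.existsUnique_character_of_finrank_eq_one h1
  obtain ⟨v₀, hv₀⟩ := exists_ne (0 : V)
  have hker : IsOpen (t₀.ker : Set (WeilGroup F)) := by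
    obtain ⟨U, -, hUo, hρU⟩ := r.isContinuous
    refine Subgroup.isOpen_mono (fun u hu => ?_) hUo
    rw [MonoidHom.mem_ker]
    ext
    refine smul_left_injective ℂ hv₀ ?_
    simp only [Units.val_one, one_smul]
    rw [← ht₀ u v₀, hρU u hu, Module.End.one_apply]
  let t : WeilGroup F →ₜ* ℂˣ := ⟨t₀, continuous_monoidHom_of_isOpen_ker t₀ hker⟩
  obtain ⟨χ, hχ⟩ := (LocalArtinData.recGL1_bijective_holds d).2 t
  have hχw : ∀ w : WeilGroup F, χ (d.artin w) = t₀ w := fun w => by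
    rw [← LocalArtinData.recGL1_apply, hχ]
    rfl
  -- the isomorphism with `ofQuasiChar hns d χ`
  have hfin : finrank ℂ V = finrank ℂ ℂ := h1.trans (Module.finrank_self ℂ).symm
  let f : V ≃ₗ[ℂ] ℂ := LinearEquiv.ofFinrankEq V ℂ hfin
  have hequiv : r.IsEquivalent (ofQuasiChar hns d χ) := by
    refine ⟨{ toRepEquiv := Representation.Equiv.mk f fun w => LinearMap.ext fun v => ?_,
              comm_N := ?_ }⟩
    · simp only [LinearMap.coe_comp, Function.comp_apply, LinearEquiv.coe_coe]
      rw [ht₀ w v, map_smul, ← ofQuasiCharOn_complex, ofQuasiCharOn_ρ_apply, hχw]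
    · rw [hN, ofQuasiChar_N, LinearMap.comp_zero, LinearMap.zero_comp]
  refine ⟨χ, hequiv, fun χ' hχ' => ?_⟩
  have h' : (ofQuasiCharOn ℂ hns d χ').IsEquivalent (ofQuasiCharOn ℂ hns d χ) :=
    hχ'.symm.trans hequiv
  exact quasiChar_eq_of_isEquivalent_ofQuasiCharOn hns d h'

end Galois

/-! ### Determinants and tensor products of one-dimensional Weil–Deligne representations -/

section TensorDet

variable {F : Type*} [Field F] [ValuativeRel F] [TopologicalSpace F] [IsNonarchimedeanLocalField F]
  {V : Type*} [AddCommGroup V] [Module ℂ V] {V' : Type*} [AddCommGroup V'] [Module ℂ V']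
  {W : Type*} [AddCommGroup W] [Module ℂ W]

/-- Isomorphic Weil–Deligne representations have the same determinant character
`w ↦ det ρ(w)` (conjugation invariance of `LinearMap.det`). [folklore] -/
theorem _root_.Literature.NumberTheory.GaloisRepresentations.WeilDeligneRep.IsEquivalent.det_ρ_eq
    {r : WeilDeligneRep F ℂ V} {r' : WeilDeligneRep F ℂ V'} (h : r.IsEquivalent r')
    (w : WeilGroup F) : LinearMap.det (r.ρ w) = LinearMap.det (r'.ρ w) := by
  obtain ⟨e⟩ := h
  have h1 : (e.toLinearEquiv : V →ₗ[ℂ] V') ∘ₗ r.ρ w = r'.ρ w ∘ₗ (e.toLinearEquiv : V →ₗ[ℂ] V') :=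
    e.toIntertwiningMap.isIntertwining' w
  have h2 : (e.toLinearEquiv : V →ₗ[ℂ] V') ∘ₗ r.ρ w ∘ₗ (e.toLinearEquiv.symm : V' →ₗ[ℂ] V) =
      r'.ρ w := by
    rw [← LinearMap.comp_assoc, h1, LinearMap.comp_assoc, LinearEquiv.comp_symm, LinearMap.comp_id]
  rw [← h2, LinearMap.det_conj]

/-- `det (χ(artin w) • id_V) = χ(artin w) ^ dim V`. [folklore] -/
theorem _root_.Literature.NumberTheory.GaloisRepresentations.WeilDeligneRep.det_ofQuasiCharOn_ρ
    [Module.Free ℂ V] (hns : WeilGroup.exists_subgroup_le_inertia_isOpen_of_continuous (F := F))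
    (d : LocalArtinData F) (χ : QuasiChar F) (w : WeilGroup F) :
    LinearMap.det ((ofQuasiCharOn V hns d χ).ρ w) = ((χ (d.artin w) : ℂˣ) : ℂ) ^ finrank ℂ V := by
  have h : (ofQuasiCharOn V hns d χ).ρ w = ((χ (d.artin w) : ℂˣ) : ℂ) • LinearMap.id :=
    LinearMap.ext fun v => rfl
  rw [h, LinearMap.det_smul, LinearMap.det_id, mul_one]

/-- An isomorphism `r ≅ r'` induces `r ⊗ s ≅ r' ⊗ s`. (Deligne, Antwerp II (1973), §8.4.1.)
[cite: II1973] -/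
def _root_.Literature.NumberTheory.GaloisRepresentations.WeilDeligneRep.Equiv.tprodLeft
    {r : WeilDeligneRep F ℂ V} {r' : WeilDeligneRep F ℂ V'} (e : Equiv r r')
    (s : WeilDeligneRep F ℂ W) : Equiv (r.tprod s) (r'.tprod s) where
  toRepEquiv := Representation.Equiv.mk
    (TensorProduct.congr e.toLinearEquiv (LinearEquiv.refl ℂ W)) fun w =>
      TensorProduct.ext' fun v x => by
        have h1 := e.toIntertwiningMap.isIntertwining r.ρ r'.ρ w v
        rw [Representation.Equiv.coe_toIntertwiningMap] at h1
        simp only [LinearMap.coe_comp, Function.comp_apply, LinearEquiv.coe_coe, tprod_ρ_apply,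
          TensorProduct.map_tmul, TensorProduct.congr_tmul, LinearEquiv.refl_apply]
        congr 1
  comm_N := TensorProduct.ext' fun v x => by
    have h1 : e.toLinearEquiv (r.N v) = r'.N (e.toLinearEquiv v) := congr($(e.comm_N) v)
    rw [Representation.Equiv.toLinearEquiv_apply] at h1
    change TensorProduct.congr e.toLinearEquiv (LinearEquiv.refl ℂ W) ((r.tprod s).N (v ⊗ₜ x)) =
      (r'.tprod s).N (TensorProduct.congr e.toLinearEquiv (LinearEquiv.refl ℂ W) (v ⊗ₜ x))
    simp only [tprod_N, LinearMap.add_apply, TensorProduct.map_tmul, map_add,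
      TensorProduct.congr_tmul, LinearEquiv.refl_apply, Module.End.one_apply,
      Representation.Equiv.toLinearEquiv_apply, h1]

/-- `IsEquivalent` is compatible with `⊗ s` on the left. [folklore] -/
theorem _root_.Literature.NumberTheory.GaloisRepresentations.WeilDeligneRep.IsEquivalent.tprodLeft
    {r : WeilDeligneRep F ℂ V} {r' : WeilDeligneRep F ℂ V'} (h : r.IsEquivalent r')
    (s : WeilDeligneRep F ℂ W) : (r.tprod s).IsEquivalent (r'.tprod s) :=
  ⟨h.some.tprodLeft s⟩

/-- **Twisting a quasi-character representation**:
`(χ₁ ∘ artin on V, 0) ⊗ (χ₂ ∘ artin, 0) ≅ ((χ₁ χ₂) ∘ artin on V, 0)` via `V ⊗ ℂ ≅ V`.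
(Tate, Corvallis 1979, (4.1.5).) [cite: Corvallis1979, (4.1.5)] -/
def _root_.Literature.NumberTheory.GaloisRepresentations.WeilDeligneRep.ofQuasiCharOnTprodEquiv
    (hns : WeilGroup.exists_subgroup_le_inertia_isOpen_of_continuous (F := F))
    (d : LocalArtinData F) (χ₁ χ₂ : QuasiChar F) :
    Equiv ((ofQuasiCharOn V hns d χ₁).tprod (ofQuasiChar hns d χ₂))
      (ofQuasiCharOn V hns d (χ₁ * χ₂)) where
  toRepEquiv := Representation.Equiv.mk (TensorProduct.rid ℂ V) fun w =>
    TensorProduct.ext' fun v x => by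
      simp only [LinearMap.coe_comp, Function.comp_apply, LinearEquiv.coe_coe, tprod_ρ_apply,
        TensorProduct.map_tmul, ofQuasiCharOn_ρ_apply, TensorProduct.rid_tmul,
        ContinuousMonoidHom.mul_apply, Units.val_mul, map_smul]
      rw [ofQuasiChar_ρ_apply, smul_smul, smul_smul]
      congr 1
      ring
  comm_N := by
    rw [tprod_N, ofQuasiCharOn_N, ofQuasiChar_N, ofQuasiCharOn_N, TensorProduct.map_zero_left,
      TensorProduct.map_zero_right, add_zero, LinearMap.comp_zero, LinearMap.zero_comp]

end TensorDet

/-! ### The reciprocity map for `GL₁` on isomorphism classes -/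

section RecOne

variable {F : Type*} [Field F] [ValuativeRel F] [TopologicalSpace F] [IsNonarchimedeanLocalField F]

/-- **The quasi-character of a class `[π] ∈ Irr(GL₁(F))`**: the unique `χ : Fˣ →ₜ* ℂˣ` with
`π(g) = χ(det g)` on every representative (`SmoothIrrep.existsUnique_quasiChar`, well defined by
`SmoothIrrep.quasiChar_transport`). (Bushnell–Henniart 2006, §1.5.) [folklore] -/
def IrrClass.quasiChar : IrrClass (GL (Fin 1) F) → QuasiChar F :=
  Quotient.lift (fun π : SmoothIrrep (GL (Fin 1) F) => (π.existsUnique_quasiChar).choose)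
    fun π π' h => h.elim fun e =>
      (π'.existsUnique_quasiChar).unique
        (SmoothIrrep.quasiChar_transport e (π.existsUnique_quasiChar).choose_spec.1)
        (π'.existsUnique_quasiChar).choose_spec.1

/-- Defining property of `IrrClass.quasiChar` on a class `[π]`: `π(g) v = χ(det g) • v`.
[folklore] -/
theorem IrrClass.quasiChar_spec (π : SmoothIrrep (GL (Fin 1) F)) (g : GL (Fin 1) F) (v : π.V) :
    π.ρ g v =
      ((IrrClass.quasiChar (IrrClass.mk π) (Matrix.GeneralLinearGroup.det g) : ℂˣ) : ℂ) • v :=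
  (π.existsUnique_quasiChar).choose_spec.1 g v

/-- `IrrClass.quasiChar [π] = χ` as soon as `π` acts through `χ ∘ det`. [folklore] -/
theorem IrrClass.quasiChar_mk_eq {π : SmoothIrrep (GL (Fin 1) F)} {χ : QuasiChar F}
    (h : ∀ (g : GL (Fin 1) F) (v : π.V),
      π.ρ g v = ((χ (Matrix.GeneralLinearGroup.det g) : ℂˣ) : ℂ) • v) :
    IrrClass.quasiChar (IrrClass.mk π) = χ :=
  (π.existsUnique_quasiChar).unique (IrrClass.quasiChar_spec π) h

/-- `IrrClass.quasiChar [χ ∘ det] = χ`. [folklore] -/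
@[simp] theorem IrrClass.quasiChar_mk_ofQuasiChar (χ : QuasiChar F) :
    IrrClass.quasiChar (IrrClass.mk (SmoothIrrep.ofQuasiChar χ)) = χ :=
  IrrClass.quasiChar_mk_eq (SmoothIrrep.ofQuasiChar_ρ_apply χ)

/-- **`Irr(GL₁(F))` is the set of quasi-characters of `Fˣ`**: `[π] ↦ χ_π` is a bijection
`Irr(GL₁(F)) ≃ (Fˣ →ₜ* ℂˣ)` with inverse `χ ↦ [χ ∘ det]`. (Bushnell–Henniart 2006, §1.5.)
[folklore] -/
theorem IrrClass.quasiChar_bijective :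
    Function.Bijective (IrrClass.quasiChar : IrrClass (GL (Fin 1) F) → QuasiChar F) := by
  refine ⟨fun c c' h => ?_, fun χ => ⟨IrrClass.mk (SmoothIrrep.ofQuasiChar χ), by simp⟩⟩
  induction c using IrrClass.ind with
  | h π =>
    induction c' using IrrClass.ind with
    | h π' =>
      have hπ := IrrClass.quasiChar_spec π
      have hπ' := IrrClass.quasiChar_spec π'
      rw [h] at hπ
      exact (SmoothIrrep.nonempty_equiv_of_quasiChar hπ hπ').elim IrrClass.mk_eq_mk_of_equiv

/-- **The reciprocity map `rec₁ : Irr(GL₁(F)) → {1-dimensional Weil–Deligne representations}/≅`**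
of local class field theory, on isomorphism classes and normalised by the local Artin datum `d`:
`[π] ↦ [(χ_π ∘ artin, N = 0)]`, where `π = χ_π ∘ det` (`IrrClass.quasiChar`), realised on the
fixed line `Fin 1 → ℂ` (`WeilDeligneRep.ofQuasiCharOn`). Every local Langlands correspondence for
the general linear groups over `F` restricts to it in degree `1`
(`IsLocalLanglandsGL.rec_one_eq_recGLOne`).
(Harris–Taylor 2001, Thm. A (i); Tate, Corvallis 1979, (1.4.5), (2.1).)
[cite: HarrisTaylor2001, Thm A (i)] -/
def recGLOne (hns : WeilGroup.exists_subgroup_le_inertia_isOpen_of_continuous (F := F))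
    (d : LocalArtinData F) : IrrClass (GL (Fin 1) F) → Quotient (frobSemisimpleWDSetoid F 1) :=
  fun c => Quotient.mk _
    ⟨ofQuasiCharOn (Fin 1 → ℂ) hns d (IrrClass.quasiChar c), isFrobSemisimple_ofQuasiCharOn hns d _⟩

/-- `rec₁ [π] = [(χ ∘ artin, 0)]` when `π` acts through `χ ∘ det`. [folklore] -/
theorem recGLOne_mk (hns : WeilGroup.exists_subgroup_le_inertia_isOpen_of_continuous (F := F))
    (d : LocalArtinData F) {π : SmoothIrrep (GL (Fin 1) F)} {χ : QuasiChar F}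
    (h : ∀ (g : GL (Fin 1) F) (v : π.V),
      π.ρ g v = ((χ (Matrix.GeneralLinearGroup.det g) : ℂˣ) : ℂ) • v) :
    recGLOne hns d (IrrClass.mk π) =
      Quotient.mk _ ⟨ofQuasiCharOn (Fin 1 → ℂ) hns d χ, isFrobSemisimple_ofQuasiCharOn hns d χ⟩ := by
  unfold recGLOne
  simp only [IrrClass.quasiChar_mk_eq h]

/-- **`rec₁` is local class field theory** (the clause `IsLocalLanglandsGL.gl_one` for `recGLOne`):
if `GL₁(F)` acts on `π` through `χ ∘ det` then `rec₁ [π] ≅ (χ ∘ artin, N = 0)`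
(`WeilDeligneRep.ofQuasiChar hns d χ`). (Harris–Taylor 2001, Thm. A (i); Tate 1979, (1.4.5).)
[cite: HarrisTaylor2001, Thm A (i)] -/
theorem recGLOne_gl_one (hns : WeilGroup.exists_subgroup_le_inertia_isOpen_of_continuous (F := F))
    (d : LocalArtinData F) (χ : QuasiChar F) (π : SmoothIrrep (GL (Fin 1) F))
    (h : ∀ (g : GL (Fin 1) F) (v : π.V),
      π.ρ g v = ((χ (Matrix.GeneralLinearGroup.det g) : ℂˣ) : ℂ) • v) :
    ((recGLOne hns d (IrrClass.mk π)).out.1).IsEquivalent (ofQuasiChar hns d χ) := by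
  rw [recGLOne_mk hns d h]
  exact (Quotient.mk_out (s := frobSemisimpleWDSetoid F 1) _).trans
    ⟨ofQuasiCharOnEquiv hns d χ (LinearEquiv.funUnique (Fin 1) ℂ ℂ)⟩

/-- **`rec₁` is a bijection** `Irr(GL₁(F)) ≃ {Frobenius-semisimple 1-dimensional Weil–Deligne
representations}/≅` (the clause `IsLocalLanglandsGL.bijective` at `n = 1` for `recGLOne`):
injective because the quasi-character is an isomorphism invariant of `(χ ∘ artin, 0)` and
classifies `Irr(GL₁(F))`; surjective because every Weil–Deligne representation on a line is some
`(χ ∘ artin, 0)` (`WeilDeligneRep.existsUnique_isEquivalent_ofQuasiChar`).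
(Harris–Taylor 2001, Thm. A; Tate 1979, (2.1), (4.1.3).) [cite: HarrisTaylor2001, Thm A] -/
theorem recGLOne_bijective (hns : WeilGroup.exists_subgroup_le_inertia_isOpen_of_continuous (F := F))
    (d : LocalArtinData F) : Function.Bijective (recGLOne hns d) := by
  refine ⟨fun c c' h => ?_, fun q => ?_⟩
  · have h' := Quotient.exact h
    exact IrrClass.quasiChar_bijective.1 (quasiChar_eq_of_isEquivalent_ofQuasiCharOn hns d h')
  · obtain ⟨χ, hχ, -⟩ := existsUnique_isEquivalent_ofQuasiChar hns d q.out.1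
      (Module.finrank_fin_fun ℂ)
    refine ⟨IrrClass.mk (SmoothIrrep.ofQuasiChar χ), ?_⟩
    rw [recGLOne_mk hns d (SmoothIrrep.ofQuasiChar_ρ_apply χ), ← q.out_eq]
    refine Quotient.sound ?_
    change (ofQuasiCharOn (Fin 1 → ℂ) hns d χ).IsEquivalent q.out.1
    exact (show (ofQuasiCharOn (Fin 1 → ℂ) hns d χ).IsEquivalent (ofQuasiChar hns d χ) from
      ⟨ofQuasiCharOnEquiv hns d χ (LinearEquiv.funUnique (Fin 1) ℂ ℂ)⟩).trans hχ.symm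

end RecOne

/-! ### The remaining degree-one clauses for `rec₁`: central characters and twists -/

section ClausesOne

variable {F : Type*} [Field F] [ValuativeRel F] [TopologicalSpace F] [IsNonarchimedeanLocalField F]

/-- `rec₁ [π]` is represented by `(χ_π ∘ artin, 0)` on `Fin 1 → ℂ`. [folklore] -/
theorem recGLOne_out_isEquivalent
    (hns : WeilGroup.exists_subgroup_le_inertia_isOpen_of_continuous (F := F))
    (d : LocalArtinData F) (π : SmoothIrrep (GL (Fin 1) F)) :
    ((recGLOne hns d (IrrClass.mk π)).out.1).IsEquivalent
      (ofQuasiCharOn (Fin 1 → ℂ) hns d (IrrClass.quasiChar (IrrClass.mk π))) :=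
  Quotient.mk_out (s := frobSemisimpleWDSetoid F 1) _

/-- **Central characters in degree one** (the clause `IsLocalLanglandsGL.centralChar` at `n = 1`
for `recGLOne`): if the central element `artin(w) · 1 ∈ GL₁(F)` acts on `π` by the scalar `c`,
then `det rec₁[π](w) = c` — both equal `χ_π(artin w)`.
(Harris–Taylor 2001, Thm. A (ii); Henniart 2000, Thm. 1.2 (4).) [cite: HarrisTaylor2001, Thm A (ii)] -/
theorem recGLOne_centralChar
    (hns : WeilGroup.exists_subgroup_le_inertia_isOpen_of_continuous (F := F))
    (d : LocalArtinData F) (π : SmoothIrrep (GL (Fin 1) F)) (w : WeilGroup F) (c : ℂ)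
    (h : π.ρ (Matrix.GeneralLinearGroup.scalar (Fin 1) (d.artin w)) = c • LinearMap.id) :
    LinearMap.det (((recGLOne hns d (IrrClass.mk π)).out.1).ρ w) = c := by
  haveI : Nontrivial π.V := Module.nontrivial_of_finrank_eq_succ π.finrank_eq_one_glOne
  have hπ := IrrClass.quasiChar_spec π
  have hc : ((IrrClass.quasiChar (IrrClass.mk π) (d.artin w) : ℂˣ) : ℂ) = c := by
    refine Module.End.smul_id_injective ℂ π.V ?_
    simp only
    rw [← h]
    refine LinearMap.ext fun v => ?_
    rw [hπ, det_scalar_fin_one, LinearMap.smul_apply, LinearMap.id_apply]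
  rw [(recGLOne_out_isEquivalent hns d π).det_ρ_eq w, det_ofQuasiCharOn_ρ, Module.finrank_fin_fun,
    pow_one, hc]

/-- The twist `π ⊗ (χ ∘ det)` of `π = χ_π ∘ det` acts through `(χ_π χ) ∘ det`. [folklore] -/
theorem SmoothIrrep.twist_charDet_ρ_apply (π : SmoothIrrep (GL (Fin 1) F)) (χ : QuasiChar F)
    (hχ : IsOpen ((χ : Fˣ →* ℂˣ).ker : Set Fˣ)) (g : GL (Fin 1) F)
    (v : (π.twist (charDet 1 χ) (isOpen_ker_charDet 1 hχ)).V) :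
    (π.twist (charDet 1 χ) (isOpen_ker_charDet 1 hχ)).ρ g v =
      (((IrrClass.quasiChar (IrrClass.mk π) * χ) (Matrix.GeneralLinearGroup.det g) : ℂˣ) : ℂ) •
        v := by
  change (π.ρ.twist (charDet 1 χ)) g v = _
  rw [Representation.twist_apply, charDet_apply, IrrClass.quasiChar_spec π g, smul_smul,
    ContinuousMonoidHom.mul_apply, Units.val_mul, mul_comm]
  rfl

/-- **Twists in degree one** (the clause `IsLocalLanglandsGL.twist` at `n = 1` for `recGLOne`):
`rec₁ [π ⊗ (χ ∘ det)] ≅ rec₁ [π] ⊗ (χ ∘ artin)`, both being `((χ_π χ) ∘ artin, 0)`.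
(Harris–Taylor 2001, Thm. A (iv); Henniart 2000, Thm. 1.2 (3).) [cite: HarrisTaylor2001, Thm A (iv)] -/
theorem recGLOne_twist
    (hns : WeilGroup.exists_subgroup_le_inertia_isOpen_of_continuous (F := F))
    (d : LocalArtinData F) (χ : QuasiChar F) (hχ : IsOpen ((χ : Fˣ →* ℂˣ).ker : Set Fˣ))
    (π : SmoothIrrep (GL (Fin 1) F)) :
    ((recGLOne hns d
        (IrrClass.twist (charDet 1 χ) (isOpen_ker_charDet 1 hχ) (IrrClass.mk π))).out.1)
      |>.IsEquivalent
        (((recGLOne hns d (IrrClass.mk π)).out.1).tprod (ofQuasiChar hns d χ)) := by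
  set χπ := IrrClass.quasiChar (IrrClass.mk π)
  -- left-hand side: `rec₁ [π ⊗ χ] = [((χ_π χ) ∘ artin, 0)]`
  have hL : ((recGLOne hns d
      (IrrClass.twist (charDet 1 χ) (isOpen_ker_charDet 1 hχ) (IrrClass.mk π))).out.1).IsEquivalent
      (ofQuasiCharOn (Fin 1 → ℂ) hns d (χπ * χ)) := by
    rw [IrrClass.twist_mk, recGLOne_mk hns d (π.twist_charDet_ρ_apply χ hχ)]
    exact Quotient.mk_out (s := frobSemisimpleWDSetoid F 1) _
  -- right-hand side: `rec₁ [π] ⊗ χ ≅ (χ_π ∘ artin, 0) ⊗ (χ ∘ artin, 0) ≅ ((χ_π χ) ∘ artin, 0)`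
  have hR : (((recGLOne hns d (IrrClass.mk π)).out.1).tprod (ofQuasiChar hns d χ)).IsEquivalent
      (ofQuasiCharOn (Fin 1 → ℂ) hns d (χπ * χ)) :=
    ((recGLOne_out_isEquivalent hns d π).tprodLeft _).trans ⟨ofQuasiCharOnTprodEquiv hns d χπ χ⟩
  exact hL.trans hR.symm

end ClausesOne

/-! ### Degree zero: `GL₀(F) = 1` and the zero Weil–Deligne representation -/

section Zero

variable {F : Type*} [Field F] [ValuativeRel F] [TopologicalSpace F] [IsNonarchimedeanLocalField F]
  {V : Type*} [AddCommGroup V] [Module ℂ V] {V' : Type*} [AddCommGroup V'] [Module ℂ V']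

omit [ValuativeRel F] [TopologicalSpace F] [IsNonarchimedeanLocalField F] in
/-- `GL₀(F)` is the trivial group. [folklore] -/
theorem subsingleton_glZero : Subsingleton (GL (Fin 0) F) :=
  ⟨fun _ _ => Units.ext (Subsingleton.elim _ _)⟩

omit [ValuativeRel F] [IsNonarchimedeanLocalField F] in
/-- An irreducible smooth representation of `GL₀(F) = 1` is the trivial representation on a line:
every `g` acts as the identity. [folklore] -/
theorem SmoothIrrep.ρ_apply_glZero (π : SmoothIrrep (GL (Fin 0) F)) (g : GL (Fin 0) F) (v : π.V) :
    π.ρ g v = v := by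
  haveI := subsingleton_glZero (F := F)
  rw [Subsingleton.elim g 1, map_one, Module.End.one_apply]

/-- Any two irreducible smooth representations of `GL₀(F)` are isomorphic (both are the trivial
representation on a line). [folklore] -/
theorem SmoothIrrep.nonempty_equiv_glZero (π π' : SmoothIrrep (GL (Fin 0) F)) :
    Nonempty (π.ρ.Equiv π'.ρ) := by
  have h1 : finrank ℂ π.V = 1 :=
    finrank_eq_one_of_isIrreducible_of_le_one π.ρ (Nat.zero_le 1) π.isSmooth
  have h1' : finrank ℂ π'.V = 1 :=
    finrank_eq_one_of_isIrreducible_of_le_one π'.ρ (Nat.zero_le 1) π'.isSmooth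
  haveI : Module.Finite ℂ π.V := Module.finite_of_finrank_eq_succ h1
  haveI : Module.Finite ℂ π'.V := Module.finite_of_finrank_eq_succ h1'
  refine ⟨Representation.Equiv.mk (LinearEquiv.ofFinrankEq π.V π'.V (h1.trans h1'.symm)) fun g =>
    LinearMap.ext fun v => ?_⟩
  simp only [LinearMap.coe_comp, Function.comp_apply, LinearEquiv.coe_coe]
  rw [π.ρ_apply_glZero, π'.ρ_apply_glZero]

/-- `Irr(GL₀(F))` is a single class. [folklore] -/
instance IrrClass.subsingleton_glZero : Subsingleton (IrrClass (GL (Fin 0) F)) :=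
  ⟨fun c c' => by
    induction c using IrrClass.ind with
    | h π =>
      induction c' using IrrClass.ind with
      | h π' => exact (SmoothIrrep.nonempty_equiv_glZero π π').elim IrrClass.mk_eq_mk_of_equiv⟩

/-- The classes of Frobenius-semisimple `0`-dimensional Weil–Deligne representations form a
single class. [folklore] -/
instance subsingleton_frobSemisimpleWDSetoid_zero :
    Subsingleton (Quotient (frobSemisimpleWDSetoid F 0)) :=
  ⟨fun q q' => Quotient.inductionOn₂ q q' fun r r' =>
    Quotient.sound (WeilDeligneRep.isEquivalent_of_subsingleton r.1 r'.1)⟩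

/-- The zero Weil–Deligne representation is Frobenius-semisimple. [folklore] -/
theorem isFrobSemisimple_trivial_zero :
    (WeilDeligneRep.trivial ℂ (Fin 0 → ℂ) : WeilDeligneRep F ℂ (Fin 0 → ℂ)).IsFrobSemisimple :=
  fun _ => Module.End.isSemisimple_id

variable (F) in
/-- The trivial representation of `GL₀(F)` on `ℂ`, as an irreducible smooth representation (it is
`χ ∘ det` for any `χ`, `det` being trivial on `GL₀`). [folklore] -/
def SmoothIrrep.trivialGLZero : SmoothIrrep (GL (Fin 0) F) where
  V := ℂ
  ρ := Representation.trivial ℂ _ ℂ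
  isIrreducible := isIrreducible_trivial_self ℂ _
  isSmooth := fun v => by
    have h : ((Representation.trivial ℂ (GL (Fin 0) F) ℂ).stabilizerSubgroup v : Set (GL (Fin 0) F)) =
        Set.univ := Set.eq_univ_of_forall fun g => by simp
    change IsOpen (((Representation.trivial ℂ (GL (Fin 0) F) ℂ).stabilizerSubgroup v :
      Set (GL (Fin 0) F)))
    rw [h]
    exact isOpen_univ

/-- **The reciprocity map in degree zero**: the unique map
`rec₀ : Irr(GL₀(F)) → {0-dimensional Weil–Deligne representations}/≅` (both sides are
singletons), `[1] ↦ [0]`. [folklore] -/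
def recGLZero : IrrClass (GL (Fin 0) F) → Quotient (frobSemisimpleWDSetoid F 0) :=
  fun _ => Quotient.mk _ ⟨WeilDeligneRep.trivial ℂ (Fin 0 → ℂ), isFrobSemisimple_trivial_zero⟩

/-- `rec₀` is a bijection (between singletons). [folklore] -/
theorem recGLZero_bijective : Function.Bijective (recGLZero (F := F)) :=
  ⟨fun _ _ _ => Subsingleton.elim _ _, fun _ =>
    ⟨IrrClass.mk (SmoothIrrep.trivialGLZero F), Subsingleton.elim _ _⟩⟩


/-- **Central characters in degree zero** (the clause `IsLocalLanglandsGL.centralChar` at `n = 0`,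
for any `rec₀`): `GL₀(F)` acts trivially, so the scalar is `1`, and the determinant of an
endomorphism of the zero space is `1`. [folklore] -/
theorem centralChar_glZero (rec0 : IrrClass (GL (Fin 0) F) → Quotient (frobSemisimpleWDSetoid F 0))
    (d : LocalArtinData F) (π : SmoothIrrep (GL (Fin 0) F)) (w : WeilGroup F) (c : ℂ)
    (h : π.ρ (Matrix.GeneralLinearGroup.scalar (Fin 0) (d.artin w)) = c • LinearMap.id) :
    LinearMap.det (((rec0 (IrrClass.mk π)).out.1).ρ w) = c := by
  have h1 : finrank ℂ π.V = 1 :=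
    finrank_eq_one_of_isIrreducible_of_le_one π.ρ (Nat.zero_le 1) π.isSmooth
  haveI : Nontrivial π.V := Module.nontrivial_of_finrank_eq_succ h1
  have hc : (1 : ℂ) = c := by
    refine Module.End.smul_id_injective ℂ π.V ?_
    simp only
    rw [← h, one_smul]
    exact (LinearMap.ext fun v => π.ρ_apply_glZero _ v).symm
  rw [← hc, LinearMap.det_eq_one_of_finrank_eq_zero (Module.finrank_fin_fun ℂ)]

/-- **Twists in degree zero** (the clause `IsLocalLanglandsGL.twist` at `n = 0`, for any `rec₀`):
both sides are Weil–Deligne representations on zero spaces. [folklore] -/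
theorem twist_glZero (hns : WeilGroup.exists_subgroup_le_inertia_isOpen_of_continuous (F := F))
    (d : LocalArtinData F)
    (rec0 : IrrClass (GL (Fin 0) F) → Quotient (frobSemisimpleWDSetoid F 0)) (χ : QuasiChar F)
    (hχ : IsOpen ((χ : Fˣ →* ℂˣ).ker : Set Fˣ)) (π : SmoothIrrep (GL (Fin 0) F)) :
    ((rec0 (IrrClass.twist (charDet 0 χ) (isOpen_ker_charDet 0 hχ) (IrrClass.mk π))).out.1)
      |>.IsEquivalent (((rec0 (IrrClass.mk π)).out.1).tprod (ofQuasiChar hns d χ)) := by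
  haveI : Subsingleton (TensorProduct ℂ (Fin 0 → ℂ) ℂ) :=
    (TensorProduct.rid ℂ (Fin 0 → ℂ)).toEquiv.subsingleton
  exact WeilDeligneRep.isEquivalent_of_subsingleton _ _

end Zero

/-! ### Every local Langlands correspondence restricts to `rec₁` -/

section Unique

variable {F : Type} [Field F] [ValuativeRel F] [TopologicalSpace F] [IsNonarchimedeanLocalField F]
  {hmul : IsFrobPow.mul (F := F)} {huniq : IsFrobPow.unique (F := F)} {hn : absInertia_normal F}
  {hex : exists_isFrobPow (F := F)}
  {hns : WeilGroup.exists_subgroup_le_inertia_isOpen_of_continuous (F := F)}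
  {d : LocalArtinData F} {𝓔 : LocalEpsilonSystem F}
  {rec : ∀ n : ℕ, IrrClass (GL (Fin n) F) → Quotient (frobSemisimpleWDSetoid F n)}

/-- **Uniqueness in degree one**: the degree-`1` component of ANY local Langlands correspondence
`rec` for the general linear groups over `F` (`IsLocalLanglandsGL F … d 𝓔 rec`; Harris–Taylor 2001,
Thm. A) is the reciprocity map `recGLOne hns d` of local class field theory — clause (i)
(`gl_one`) pins `rec₁ [π]` on every class, since every irreducible smooth `π` of `GL₁(F)` is a
quasi-character `χ ∘ det` (`SmoothIrrep.existsUnique_quasiChar`).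
(Harris–Taylor 2001, Thm. A (i); Henniart 2000, Thm. 1.2.) [cite: HarrisTaylor2001, Thm A (i)] -/
theorem IsLocalLanglandsGL.rec_one_eq_recGLOne (h : IsLocalLanglandsGL F hmul huniq hn hex hns d 𝓔 rec) :
    rec 1 = recGLOne hns d := by
  funext c
  induction c using IrrClass.ind with
  | h π =>
    obtain ⟨χ, hχ, -⟩ := π.existsUnique_quasiChar
    have h1 := h.gl_one χ π hχ
    have h2 := recGLOne_gl_one hns d χ π hχ
    exact Quotient.out_equiv_out.1 (h1.trans h2.symm)

/-- In particular `rec₁ [π] = [(χ ∘ artin, 0)]` for every local Langlands correspondence `rec` and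
every irreducible smooth `π = χ ∘ det` of `GL₁(F)`. [cite: HarrisTaylor2001, Thm A (i)] -/
theorem IsLocalLanglandsGL.rec_one_mk (h : IsLocalLanglandsGL F hmul huniq hn hex hns d 𝓔 rec)
    {π : SmoothIrrep (GL (Fin 1) F)} {χ : QuasiChar F}
    (hχ : ∀ (g : GL (Fin 1) F) (v : π.V),
      π.ρ g v = ((χ (Matrix.GeneralLinearGroup.det g) : ℂˣ) : ℂ) • v) :
    rec 1 (IrrClass.mk π) =
      Quotient.mk _ ⟨ofQuasiCharOn (Fin 1 → ℂ) hns d χ, isFrobSemisimple_ofQuasiCharOn hns d χ⟩ := by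
  rw [h.rec_one_eq_recGLOne, recGLOne_mk hns d hχ]

/-- **Uniqueness in degree zero**: the degree-`0` component of any local Langlands correspondence
is `recGLZero` (both sides are singletons). [folklore] -/
theorem IsLocalLanglandsGL.rec_zero_eq_recGLZero
    (_h : IsLocalLanglandsGL F hmul huniq hn hex hns d 𝓔 rec) : rec 0 = recGLZero :=
  funext fun _ => Subsingleton.elim _ _

end Unique

end Literature.NumberTheory.Automorphic

end
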